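import Summits.KontsevichZagierPeriods.KontsevichZagierPeriods.Theorems.SoloBlindThreeConjuncts
import Literature.NumberTheory.Transcendental.KZKernelConjectureForms
import HarnessLib

/-!
# The summit statement is *equivalent* to injectivity of the period map, and splits as
# `(R) ∧ (C) ∧ (T)`

`SoloBlind.kz_of_injective_evalQ` derived the summit statement
`Literature.Periods.KZPeriodConjecture` (two rational integral representations with the same
value are connected by the three rules) from the injectivity of the period map `evalQ : Q →+* ℝ`
on the formal period ring. Here the converse is recorded — via the Literature comparison of the
kernel form with KZ's literal two-representation form
(`Literature.NumberTheory.Transcendental.kzKernelConjecture_iff_isRational`) — so that every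
ring-theoretic reformulation of injectivity becomes a reformulation **of the summit statement
itself**:

* `SoloBlind.kz_iff_injective_evalQ` : `KZPeriodConjecture ↔ Injective evalQ`;
* `SoloBlind.kz_iff_noZeroDivisors_transcendental` : `KZPeriodConjecture ↔ (D) ∧ (T)`;
* `SoloBlind.kz_iff_reduced_cancel_transcendental` : `KZPeriodConjecture ↔ (R) ∧ (C) ∧ (T)` with
  `(R)` `Q` reduced, `(C)` cancellation by classes of non-zero period, `(T)` transcendence
  (`SoloBlindThreeConjuncts`);
* `SoloBlind.isReduced_of_kz`, `SoloBlind.cancel_of_kz`, `SoloBlind.transcendental_of_kz` : each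
  conjunct is a **necessary** condition — any proof of the summit statement proves, in particular,
  that the Kontsevich–Zagier calculus is *reduced* (if `∫∫_{σ×σ} f(x) f(y)` can be moved to the
  empty integral then so can `∫_σ f`) and *cancellative by representations of non-zero period*;
* `SoloBlind.kz_iff_isReduced` : granted `(C)` and `(T)`, the summit statement is equivalent to
  the reducedness of `Q` alone, i.e. to the absence of *nilpotent periods*: representations `R` of
  (necessarily) period `0` whose self-product is killed by the rules while `R` is not;
* `SoloBlind.kz_iff_rep_conjuncts` : the summit statement as three statements about single
  integral representations.
-/

namespace Summit.KontsevichZagierPeriods.KontsevichZagierPeriods.Theorems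

open Literature.NumberTheory.Transcendental
open Literature.NumberTheory.Transcendental.KZ

namespace SoloBlind

/-- **The summit statement is equivalent to the injectivity of the period map `evalQ`.** -/
theorem kz_iff_injective_evalQ :
    Literature.Periods.KZPeriodConjecture ↔ Function.Injective evalQ := by
  rw [injective_evalQ_iff_kernel]
  exact kzKernelConjecture_iff_isRational.symm

/-- The summit statement in kernel form: every formal `ℤ`-combination of integral representations
of total period `0` is a consequence of the three rules. -/
theorem kz_iff_kernel :
    Literature.Periods.KZPeriodConjecture ↔ ∀ z : FormalRep, eval z = 0 → z ∈ relations :=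
  kz_iff_injective_evalQ.trans injective_evalQ_iff_kernel

/-- **`S ↔ (D) ∧ (T)`**: the summit statement holds iff the formal period ring has no zero-divisors
and formally transcendental classes have transcendental periods. -/
theorem kz_iff_noZeroDivisors_transcendental :
    Literature.Periods.KZPeriodConjecture ↔ NoZeroDivisors Q ∧
      ∀ x : Q, Transcendental K₀ x → Transcendental K₀ (evalQ x) :=
  kz_iff_injective_evalQ.trans injective_evalQ_iff_transcendental

/-- **`S ↔ (R) ∧ (C) ∧ (T)`**: the summit statement holds iff `Q` is reduced, classes of non-zero
period are cancellable, and formally transcendental classes have transcendental periods. -/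
theorem kz_iff_reduced_cancel_transcendental :
    Literature.Periods.KZPeriodConjecture ↔ IsReduced Q ∧
      (∀ x y : Q, evalQ y ≠ 0 → x * y = 0 → x = 0) ∧
      ∀ x : Q, Transcendental K₀ x → Transcendental K₀ (evalQ x) :=
  kz_iff_injective_evalQ.trans injective_evalQ_iff_reduced_cancel

/-! ## The three conjuncts are necessary -/

/-- **Any proof of the summit statement proves that `Q` is reduced.** -/
theorem isReduced_of_kz (h : Literature.Periods.KZPeriodConjecture) : IsReduced Q :=
  (kz_iff_reduced_cancel_transcendental.mp h).1

/-- **Any proof of the summit statement proves cancellation by classes of non-zero period.** -/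
theorem cancel_of_kz (h : Literature.Periods.KZPeriodConjecture) {x y : Q} (hy : evalQ y ≠ 0)
    (hxy : x * y = 0) : x = 0 :=
  (kz_iff_reduced_cancel_transcendental.mp h).2.1 x y hy hxy

/-- Any proof of the summit statement proves the transcendence transfer `(T)`. -/
theorem transcendental_of_kz (h : Literature.Periods.KZPeriodConjecture) {x : Q}
    (hx : Transcendental K₀ x) : Transcendental K₀ (evalQ x) :=
  (kz_iff_reduced_cancel_transcendental.mp h).2.2 x hx

/-- Any proof of the summit statement proves that `Q` has no zero-divisors. -/
theorem noZeroDivisors_of_kz (h : Literature.Periods.KZPeriodConjecture) : NoZeroDivisors Q :=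
  (kz_iff_noZeroDivisors_transcendental.mp h).1

/-- **Necessity on representations (R)**: under the summit statement, if the self-product of a
representation is killed by the rules then so is the representation. -/
theorem rep_reduced_of_kz (h : Literature.Periods.KZPeriodConjecture) {N : ℕ} (R : IntegralRep N)
    (hRR : of (R.prod R) ∈ relations) : of R ∈ relations :=
  isReduced_iff_rep.mp (isReduced_of_kz h) N R hRR

/-- **Necessity on representations (C)**: under the summit statement, if `∫ s ≠ 0` and `r × s` is
killed by the rules then so is `r`. -/
theorem rep_cancel_of_kz (h : Literature.Periods.KZPeriodConjecture) {n m : ℕ} (r : IntegralRep n)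
    (s : IntegralRep m) (hs : s.value ≠ 0) (hrs : of (r.prod s) ∈ relations) : of r ∈ relations :=
  cancel_iff_rep.mp (fun _ _ hy hxy => cancel_of_kz h hy hxy) n m r s hs hrs

/-! ## Granted cancellation and transcendence, the summit statement is reducedness -/

/-- **Granted `(C)` and `(T)`, the summit statement is equivalent to the reducedness of `Q`.** -/
theorem kz_iff_isReduced (hC : ∀ x y : Q, evalQ y ≠ 0 → x * y = 0 → x = 0)
    (hT : ∀ x : Q, Transcendental K₀ x → Transcendental K₀ (evalQ x)) :
    Literature.Periods.KZPeriodConjecture ↔ IsReduced Q :=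
  ⟨isReduced_of_kz, fun hR => kz_iff_reduced_cancel_transcendental.mpr ⟨hR, hC, hT⟩⟩

/-- **Granted `(C)` and `(T)`, the summit statement says exactly: there are no nilpotent periods** —
no representation whose self-product is killed by the rules while it is not. -/
theorem kz_iff_no_nilpotent_rep (hC : ∀ x y : Q, evalQ y ≠ 0 → x * y = 0 → x = 0)
    (hT : ∀ x : Q, Transcendental K₀ x → Transcendental K₀ (evalQ x)) :
    Literature.Periods.KZPeriodConjecture ↔
      ∀ (N : ℕ) (R : IntegralRep N), of (R.prod R) ∈ relations → of R ∈ relations :=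
  (kz_iff_isReduced hC hT).trans isReduced_iff_rep

/-- Granted `(C)` and `(T)`, a formal combination of period `0` which is *not* a relation — a
counterexample to the summit statement — is nilpotent in `Q`. -/
theorem isNilpotent_of_counterexample (hC : ∀ x y : Q, evalQ y ≠ 0 → x * y = 0 → x = 0)
    (hT : ∀ x : Q, Transcendental K₀ x → Transcendental K₀ (evalQ x)) {z : FormalRep}
    (hz : eval z = 0) : IsNilpotent (mkQ z) :=
  (evalQ_eq_zero_iff_isNilpotent hC hT (mkQ z)).mp (by rw [evalQ_mkQ, hz])

/-! ## The summit statement on single representations -/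

/-- **The summit statement as three statements about single integral representations.** -/
theorem kz_iff_rep_conjuncts :
    Literature.Periods.KZPeriodConjecture ↔
      (∀ (N : ℕ) (R : IntegralRep N), of (R.prod R) ∈ relations → of R ∈ relations) ∧
      (∀ (n m : ℕ) (r : IntegralRep n) (s : IntegralRep m), s.value ≠ 0 →
        of (r.prod s) ∈ relations → of r ∈ relations) ∧
      ∀ (N : ℕ) (R : IntegralRep N), IsAlgebraic K₀ R.value → IsAlgebraic K₀ (mkQ (of R)) := by
  rw [kz_iff_reduced_cancel_transcendental, isReduced_iff_rep, cancel_iff_rep,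
    transcendence_iff_rep]

end SoloBlind

end Summit.KontsevichZagierPeriods.KontsevichZagierPeriods.Theorems
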